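import Literature.Barriers.QuantumAdvantage.FFKLCertificates
import Literature.Computability.Complexity.CHFunctions
import HarnessLib

/-!
# The `PSPACE` side of the Standard Algorithm for `AWPP^{B ⊕ G}` (Fenner–Fortnow–Kurtz–Li, Lemma 6.16/6.17 with `P^B = PSPACE`): the oracle language spelling least good codes

Support file for the named fact
`Literature.Barriers.QuantumAdvantage.fennerFortnowKurtzLi2003_thm618_awpp` (Fenner–Fortnow–
Kurtz–Li, *An oracle builder's toolkit*, Inform. and Comput. 182 (2003), Thm. 6.18 (2)
rerelativized), continuing `FFKLCertificates.lean` (the supplier `pick` of least good codes and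
its specification, Lemma 6.17) and `FFKLSegments.lean` (the segment format).

Lemma 6.16 (p. 33) puts the language of a categorical machine in `P^{G ⊕ F_j}`, where `F_j(x, α)`
is the function of the Standard Algorithm; Lemma 6.17 and the remark after it give
`F_j ∈ FPSPACE` for `AWPP`, and Thm. 6.18 (2) concludes with `P = PSPACE` (relative to the
`PSPACE`-complete `B`, pp. 33–34). In the tree a `P^{B ⊕ G}` machine receives ONE BIT per query,
so `F_j` is delivered bitwise by a LANGUAGE `K ∈ PSPACE` (then Karp-reduced to `B`), in a
fixed-width protocol whose positions both sides recover by unary arithmetic on the length of the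
answer history `h` (`Plumb.divModFn`, `UnaryOffsets.mulLenFn`):

* the size polynomials of a description: `AWPPDescr.reachPoly ≥ reach` (`reach_le_reachPoly`),
  the code width `codeW = 2·reachPoly + 4`, segment width `segW = codeW + 1`, slots per round
  `slots = 16·reachPoly⁴` (`≥` the certificate bound), rounds `rounds = 4·reachPoly²` (`≥` the
  block sensitivity), code length `codeLen = slots·segW`, history length `histLen = rounds·codeLen`;
* the `FP` position maps on `⟨x, h⟩` (`KSide.soFn`, `rkFn`, `prefFn`, `idxFn`, `cpFn`: segments
  done and offset, round and slot, the history prefix of the completed rounds, the bit index into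
  the current round's code, the code part received in the current segment) with their semantics;
* **the language `K`** (`AWPPDescr.KLang`): on `⟨x, h⟩` — if `|h| = histLen(n)` (the verdict
  query), "`⟨x, ⟨x, ⟨h, ⟨ε, ε⟩⟩⟩⟩ ∈ accTable`" (the verdict `f(fill(knowledge of h))`,
  `layerFill_knowOf_nil`); otherwise "bit `k·W + o` of the least good code of length `codeLen(n)`
  over the knowledge read off the completed rounds of `h` is `1`" — assembled from the table test
  `accTable ∈ PSPACE` (`FFKLTablePredicate.lean`) over the layered table `layerTBL`
  (`FFKLSegments.lean`) by bounded quantifiers and Boolean combinations (`PSpaceClosure.lean`):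
  **`KLang_mem_PSPACE`**;
* its semantics **`mem_KLang_iff_kbit`**: `⟨x, h⟩ ∈ K ↔ kbit x h = 1`, where `AWPPDescr.kbit` is
  the intended bit (verdict, or bit of the least good code `AWPPDescr.roundCode` over
  `knowOf (prefix)`, `0` if no code is good).

## References

* [FennerFortnowKurtzLi2003IC] Lemma 6.16, Lemma 6.17 and the remark after it, Thm. 6.18 (2)
  (p. 33), pp. 33–34 (rerelativization), Fig. 1 (p. 29), read via
  `lit read doi:10.1016/s0890-5401(03)00018-x --pages 25-34`.
* [AroraBarakCC2009] §1.3 (unary counters, addressing), §4.2 (`PSPACE`), Thm. 4.2.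
-/

noncomputable section

namespace Literature.Barriers.QuantumAdvantage

open _root_.Computability Literature.Computability.Complexity Literature.Computability.Complexity.Classes
  Literature.Computability.Complexity.CohenCondition Literature.Computability.QuantumComplexity
  Polynomial OracleCompose UnaryOffsets CertificateAlgorithm FFKL

/-! ### Size polynomials of a description -/

namespace AWPPDescr

/-- A polynomial bound `reachPoly ≥ reach` (the sum of the two fuels). [cite: FennerFortnowKurtzLi2003IC, §6.4 (p. 31, nᵏ)] -/
def reachPoly (Δ : AWPPDescr) : Polynomial ℕ :=
  Δ.q₁.comp (2 * X + 2 + Δ.r₁) + Δ.q₂.comp (2 * X + 2 + Δ.r₂)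

/-- The code width `T = 2·reachPoly + 4` (room for the code of every string of length `≤ reachPoly + 1`). [cite: FennerFortnowKurtzLi2003IC, Lemma 6.16 (p. 33)] -/
def codeW (Δ : AWPPDescr) : Polynomial ℕ := 2 * Δ.reachPoly + 4

/-- The segment width `W = T + 1` (code and value bit). [cite: FennerFortnowKurtzLi2003IC, Lemma 6.16 (p. 33)] -/
def segW (Δ : AWPPDescr) : Polynomial ℕ := Δ.codeW + 1

/-- The number of slots (segments) of a code: `16·reachPoly⁴ ≥` the certificate bound of Thm. 6.13. [cite: FennerFortnowKurtzLi2003IC, Thm. 6.13 (pp. 31–32)] -/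
def slots (Δ : AWPPDescr) : Polynomial ℕ := 16 * Δ.reachPoly ^ 4

/-- The number of rounds: `4·reachPoly² ≥` the block sensitivity (Lemma 6.9: at most that many iterations). [cite: FennerFortnowKurtzLi2003IC, Lemma 6.9 (p. 29)] -/
def rounds (Δ : AWPPDescr) : Polynomial ℕ := 4 * Δ.reachPoly ^ 2

/-- The code length `Lc = slots · W`. [cite: FennerFortnowKurtzLi2003IC, Lemma 6.17 (p. 33, polynomial-size β)] -/
def codeLen (Δ : AWPPDescr) : Polynomial ℕ := Δ.slots * Δ.segW

/-- The length of the full history of probing rounds `rounds · Lc` (the position of the verdict query). [cite: FennerFortnowKurtzLi2003IC, Lemma 6.16 (p. 33)] -/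
def histLen (Δ : AWPPDescr) : Polynomial ℕ := Δ.rounds * Δ.codeLen

variable (Δ : AWPPDescr)

/-- `reachPoly = fuel₁ + fuel₂`. [folklore] -/
theorem reachPoly_eval (n : ℕ) : Δ.reachPoly.eval n = Δ.fuel₁ n + Δ.fuel₂ n := by
  simp [reachPoly, fuel₁, fuel₂]

/-- `reach ≤ reachPoly`. [folklore] -/
theorem reach_le_reachPoly (n : ℕ) : Δ.reach n ≤ Δ.reachPoly.eval n := by
  rw [reachPoly_eval, reach]
  exact max_le (Nat.le_add_right _ _) (Nat.le_add_left _ _)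

/-- `codeW = 2·reachPoly + 4`. [folklore] -/
theorem codeW_eval (n : ℕ) : Δ.codeW.eval n = 2 * Δ.reachPoly.eval n + 4 := by
  simp [codeW]

/-- `segW = codeW + 1`. [folklore] -/
theorem segW_eval (n : ℕ) : Δ.segW.eval n = Δ.codeW.eval n + 1 := by
  simp [segW]

/-- `slots = 16·reachPoly⁴`. [folklore] -/
theorem slots_eval (n : ℕ) : Δ.slots.eval n = 16 * Δ.reachPoly.eval n ^ 4 := by
  simp [slots]

/-- `rounds = 4·reachPoly²`. [folklore] -/
theorem rounds_eval (n : ℕ) : Δ.rounds.eval n = 4 * Δ.reachPoly.eval n ^ 2 := by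
  simp [rounds]

/-- `codeLen = slots · segW`. [folklore] -/
theorem codeLen_eval (n : ℕ) : Δ.codeLen.eval n = Δ.slots.eval n * Δ.segW.eval n := by
  simp [codeLen]

/-- `histLen = rounds · codeLen`. [folklore] -/
theorem histLen_eval (n : ℕ) : Δ.histLen.eval n = Δ.rounds.eval n * Δ.codeLen.eval n := by
  simp [histLen]

/-- The width hypothesis of the certificate layer: `2·reach + 2 ≤ W - 1`. [folklore] -/
theorem two_reach_le_segW (n : ℕ) : 2 * Δ.reach n + 2 ≤ Δ.segW.eval n - 1 := by
  have := Δ.reach_le_reachPoly n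
  rw [segW_eval, codeW_eval]
  omega

/-- The slots hypothesis of the certificate layer: `16·reach⁴ ≤ slots`. [folklore] -/
theorem certBound_le_slots (n : ℕ) : 16 * Δ.reach n ^ 4 ≤ Δ.slots.eval n := by
  rw [slots_eval]
  exact Nat.mul_le_mul_left _ (Nat.pow_le_pow_left (Δ.reach_le_reachPoly n) 4)

/-- The segment width is positive. [folklore] -/
theorem segW_pos (n : ℕ) : 0 < Δ.segW.eval n := by
  rw [segW_eval]; omega

/-- The slot count is irrelevant to positivity of the code length only through `segW`; we record
`codeLen = slots·segW` with `segW ≥ 1`. [folklore] -/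
theorem slots_mul_segW (n : ℕ) : Δ.slots.eval n * Δ.segW.eval n = Δ.codeLen.eval n :=
  (Δ.codeLen_eval n).symm

end AWPPDescr

/-! ### Position maps on `⟨x, h⟩` -/

namespace KSide

variable (Wp Csp Lcp : Polynomial ℕ)

/-- `⟨x, h⟩ ↦ ⟨1^{|h| / W}, 1^{|h| mod W}⟩` (segments completed, offset in the current one), `W = Wp(|x|)`. [cite: AroraBarakCC2009, §1.3 (counters)] -/
def soFn : List Bool → List Bool :=
  Plumb.divModFn ∘ pairFn (Plumb.polyFn Wp ∘ fstP) (onesFn ∘ sndP)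

/-- `⟨x, h⟩ ↦ ⟨1^{S / Cs}, 1^{S mod Cs}⟩` (round and slot), `S = |h| / W`, `Cs = Csp(|x|)`. [cite: AroraBarakCC2009, §1.3] -/
def rkFn : List Bool → List Bool :=
  Plumb.divModFn ∘ pairFn (Plumb.polyFn Csp ∘ fstP) (fstP ∘ soFn Wp)

/-- `⟨x, h⟩ ↦ h ↾ (r · Lc)` (the history of the completed rounds), `r = S / Cs`, `Lc = Lcp(|x|)`. [cite: AroraBarakCC2009, §1.3] -/
def prefFn : List Bool → List Bool :=
  Plumb.takeFn ∘ pairFn (mulLenFn ∘ pairFn (fstP ∘ rkFn Wp Csp) (Plumb.polyFn Lcp ∘ fstP)) sndP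

/-- `⟨x, h⟩ ↦` a unary string of length `k · W + o` (the bit index into the round's code), `k = S mod Cs`, `o = |h| mod W`. [cite: AroraBarakCC2009, §1.3] -/
def idxFn : List Bool → List Bool :=
  concatFn ∘ pairFn (mulLenFn ∘ pairFn (sndP ∘ rkFn Wp Csp) (Plumb.polyFn Wp ∘ fstP)) (sndP ∘ soFn Wp)

/-- `⟨x, h⟩ ↦ h ⇂ (S · W)` (the code part received in the current segment). [cite: AroraBarakCC2009, §1.3] -/
def cpFn : List Bool → List Bool :=
  Plumb.dropFn ∘ pairFn (mulLenFn ∘ pairFn (fstP ∘ soFn Wp) (Plumb.polyFn Wp ∘ fstP)) sndP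

/-- `soFn ∈ FP`. [folklore] -/
theorem soFn_mem_FP : soFn Wp ∈ FP :=
  comp_mem_FP Plumb.divModFn_mem_FP (pairFn_mem_FP (comp_mem_FP (Plumb.polyFn_mem_FP Wp) fstP_mem_FP)
    (comp_mem_FP onesFn_mem_FP sndP_mem_FP))

/-- `rkFn ∈ FP`. [folklore] -/
theorem rkFn_mem_FP : rkFn Wp Csp ∈ FP :=
  comp_mem_FP Plumb.divModFn_mem_FP (pairFn_mem_FP (comp_mem_FP (Plumb.polyFn_mem_FP Csp) fstP_mem_FP)
    (comp_mem_FP fstP_mem_FP (soFn_mem_FP Wp)))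

/-- `prefFn ∈ FP`. [folklore] -/
theorem prefFn_mem_FP : prefFn Wp Csp Lcp ∈ FP :=
  comp_mem_FP Plumb.takeFn_mem_FP (pairFn_mem_FP (comp_mem_FP mulLenFn_mem_FP (pairFn_mem_FP
    (comp_mem_FP fstP_mem_FP (rkFn_mem_FP Wp Csp)) (comp_mem_FP (Plumb.polyFn_mem_FP Lcp) fstP_mem_FP))) sndP_mem_FP)

/-- `idxFn ∈ FP`. [folklore] -/
theorem idxFn_mem_FP : idxFn Wp Csp ∈ FP :=
  comp_mem_FP concatFn_mem_FP (pairFn_mem_FP (comp_mem_FP mulLenFn_mem_FP (pairFn_mem_FP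
    (comp_mem_FP sndP_mem_FP (rkFn_mem_FP Wp Csp)) (comp_mem_FP (Plumb.polyFn_mem_FP Wp) fstP_mem_FP)))
    (comp_mem_FP sndP_mem_FP (soFn_mem_FP Wp)))

/-- `cpFn ∈ FP`. [folklore] -/
theorem cpFn_mem_FP : cpFn Wp ∈ FP :=
  comp_mem_FP Plumb.dropFn_mem_FP (pairFn_mem_FP (comp_mem_FP mulLenFn_mem_FP (pairFn_mem_FP
    (comp_mem_FP fstP_mem_FP (soFn_mem_FP Wp)) (comp_mem_FP (Plumb.polyFn_mem_FP Wp) fstP_mem_FP))) sndP_mem_FP)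

/-- `mulLenFn ⟨1ᵃ, 1ᵇ⟩ = 1^{a·b}`. [folklore] -/
theorem mulLenFn_ones (a b : ℕ) : mulLenFn (boolPair (ones a) (ones b)) = ones (a * b) := by
  rw [mulLenFn_boolPair, List.length_replicate]
  induction a with
  | zero => simp
  | succ a ih => rw [List.replicate_succ, List.flatten_cons, ih, Nat.succ_mul, Nat.add_comm, ones, ones, ones, List.replicate_add]

variable {Wp Csp Lcp}

/-- Semantics of `soFn`. [folklore] -/
theorem soFn_apply (x h : List Bool) :
    soFn Wp (boolPair x h) =
      boolPair (ones (h.length / Wp.eval x.length)) (ones (h.length % Wp.eval x.length)) := by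
  simp only [soFn, Function.comp_apply, pairFn_apply, fstP_boolPair, sndP_boolPair, Plumb.polyFn_apply, onesFn_eq_replicate,
    Plumb.divModFn_boolPair]

/-- Semantics of `rkFn`. [folklore] -/
theorem rkFn_apply (x h : List Bool) :
    rkFn Wp Csp (boolPair x h) =
      boolPair (ones (h.length / Wp.eval x.length / Csp.eval x.length))
        (ones (h.length / Wp.eval x.length % Csp.eval x.length)) := by
  simp only [rkFn, Function.comp_apply, pairFn_apply, fstP_boolPair, soFn_apply, Plumb.polyFn_apply, Plumb.divModFn_boolPair]

/-- Semantics of `prefFn`. [folklore] -/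
theorem prefFn_apply (x h : List Bool) :
    prefFn Wp Csp Lcp (boolPair x h) = h.take (h.length / Wp.eval x.length / Csp.eval x.length * Lcp.eval x.length) := by
  simp only [prefFn, Function.comp_apply, pairFn_apply, fstP_boolPair, sndP_boolPair, rkFn_apply, Plumb.polyFn_apply,
    mulLenFn_ones, Plumb.takeFn_boolPair, List.length_replicate]

/-- Semantics of `idxFn` (its length). [folklore] -/
theorem length_idxFn_apply (x h : List Bool) :
    (idxFn Wp Csp (boolPair x h)).length =
      h.length / Wp.eval x.length % Csp.eval x.length * Wp.eval x.length + h.length % Wp.eval x.length := by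
  simp only [idxFn, Function.comp_apply, pairFn_apply, fstP_boolPair, sndP_boolPair, rkFn_apply, soFn_apply,
    Plumb.polyFn_apply, mulLenFn_ones, concatFn_boolPair, List.length_append, List.length_replicate]

/-- Semantics of `cpFn`. [folklore] -/
theorem cpFn_apply (x h : List Bool) :
    cpFn Wp (boolPair x h) = h.drop (h.length / Wp.eval x.length * Wp.eval x.length) := by
  simp only [cpFn, Function.comp_apply, pairFn_apply, fstP_boolPair, sndP_boolPair, soFn_apply, Plumb.polyFn_apply,
    mulLenFn_ones, Plumb.dropFn_boolPair, List.length_replicate]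

end KSide

/-! ### The language `K` -/

namespace AWPPDescr

section Defs

variable (Δ : AWPPDescr) (B : Language Bool) (σ : CohenCondition)

/-- The layered table of the protocol (segment width `segW`). [cite: FennerFortnowKurtzLi2003IC, Lemma 6.17 (p. 33)] -/
def TBL : Language Bool := layerTBL σ Δ.segW

/-- `⟨⟨⟨x, h⟩, c⟩, γ⟩ ↦ ⟨x, ⟨x, ⟨h', ⟨c, γ⟩⟩⟩⟩` (`h'` the history of the completed rounds): the input
of the table test. [cite: FennerFortnowKurtzLi2003IC, Lemma 6.17 (p. 33)] -/
def tmapFn : List Bool → List Bool :=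
  pairFn (fstP ∘ fstP ∘ fstP) (pairFn (fstP ∘ fstP ∘ fstP)
    (pairFn (KSide.prefFn Δ.segW Δ.slots Δ.codeLen ∘ fstP ∘ fstP) (pairFn (sndP ∘ fstP) sndP)))

/-- "The table `(h', c, γ)` makes `x` accept" as a language of `⟨⟨⟨x, h⟩, c⟩, γ⟩`. [cite: FennerFortnowKurtzLi2003IC, Lemma 6.17 (p. 33, "M^{α∪β∪γ}(x) accepts")] -/
def AccG : Language Bool := {w | Δ.tmapFn w ∈ accTable B (Δ.TBL σ) Δ}

/-- "`|γ| = Lc(|x|)`" as a language of `⟨⟨⟨x, h⟩, c⟩, γ⟩`. [folklore] -/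
def LenEqG : Language Bool := {w | (onesFn ∘ sndP) w = (Plumb.polyFn Δ.codeLen ∘ fstP ∘ fstP ∘ fstP) w}

/-- The matrix of the certificate test: "if `|γ| = Lc` then the table accepts". [cite: FennerFortnowKurtzLi2003IC, Lemma 6.17 (p. 33)] -/
def ImpG : Language Bool := {w | w ∈ Δ.LenEqG → w ∈ Δ.AccG B σ}

/-- **"`c` is good over the completed rounds of `h`"** as a language of `⟨⟨x, h⟩, c⟩`: for all
completions `γ` of the code length, the table accepts. [cite: FennerFortnowKurtzLi2003IC, Lemma 6.17 (p. 33, "β is a 1-certificate iff, for all γ …")] -/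
def GoodL : Language Bool :=
  {v | ∀ g : List Bool, g.length ≤ (X : Polynomial ℕ).eval v.length → boolPair v g ∈ Δ.ImpG B σ}

/-- "`|c| = Lc(|x|)`" as a language of `⟨⟨x, h⟩, c⟩`. [folklore] -/
def LenEqC : Language Bool := {v | (onesFn ∘ sndP) v = (Plumb.polyFn Δ.codeLen ∘ fstP ∘ fstP) v}

/-- "`|c'| = Lc(|x|)` and `c' < c`" as a language of `⟨⟨⟨x, h⟩, c⟩, c'⟩`. [folklore] -/
def LenLtC : Language Bool :=
  {w | (onesFn ∘ sndP) w = (Plumb.polyFn Δ.codeLen ∘ fstP ∘ fstP ∘ fstP) w ∧ bitsToNat (sndP w) < bitsToNat (sndP (fstP w))}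

/-- "`c'` is not good" as a language of `⟨⟨⟨x, h⟩, c⟩, c'⟩`. [folklore] -/
def NotGoodC : Language Bool := {w | ¬ pairFn (fstP ∘ fstP) sndP w ∈ Δ.GoodL B σ}

/-- The matrix of minimality: a smaller code of the right length is not good. [cite: FennerFortnowKurtzLi2003IC, Lemma 6.17 (p. 33, prefix search)] -/
def ImpMin : Language Bool := {w | w ∈ Δ.LenLtC → w ∈ Δ.NotGoodC B σ}

/-- "every smaller code of the right length is not good" as a language of `⟨⟨x, h⟩, c⟩`. [cite: FennerFortnowKurtzLi2003IC, Lemma 6.17 (p. 33)] -/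
def MinL : Language Bool :=
  {v | ∀ c' : List Bool, c'.length ≤ (X : Polynomial ℕ).eval v.length → boolPair v c' ∈ Δ.ImpMin B σ}

/-- **"`c` is the least good code"** as a language of `⟨⟨x, h⟩, c⟩`. [cite: FennerFortnowKurtzLi2003IC, Lemma 6.17 (p. 33)] -/
def LeastL : Language Bool := {v | v ∈ Δ.LenEqC ∧ (v ∈ Δ.GoodL B σ ∧ v ∈ Δ.MinL B σ)}

/-- "bit `k·W + o` of `c` is `1`" as a language of `⟨⟨x, h⟩, c⟩`. [cite: AroraBarakCC2009, §1.3 (addressing)] -/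
def CodeBit : Language Bool :=
  {v | ((sndP v).drop ((KSide.idxFn Δ.segW Δ.slots ∘ fstP) v).length).head? = some true}

/-- "`c` is the least good code and its addressed bit is `1`". [cite: FennerFortnowKurtzLi2003IC, Lemma 6.16 (p. 33)] -/
def LeastBit : Language Bool := {v | v ∈ Δ.LeastL B σ ∧ v ∈ Δ.CodeBit}

/-- **The code queries**: "the addressed bit of the least good code over the completed rounds is `1`",
a language of `⟨x, h⟩`. [cite: FennerFortnowKurtzLi2003IC, Lemma 6.16 (p. 33)] -/
def Kcode : Language Bool :=
  {u | ∃ c : List Bool, c.length ≤ Δ.codeLen.eval u.length ∧ boolPair u c ∈ Δ.LeastBit B σ}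

/-- `⟨x, h⟩ ↦ ⟨x, ⟨x, ⟨h, ⟨ε, ε⟩⟩⟩⟩`: the input of the verdict test. [cite: FennerFortnowKurtzLi2003IC, Fig. 1 (p. 29)] -/
def finFn : List Bool → List Bool :=
  pairFn fstP (pairFn fstP (pairFn sndP fun _ => boolPair [] []))

/-- **The verdict query**: "the table of the full history (no candidate, no completion) makes `x`
accept". [cite: FennerFortnowKurtzLi2003IC, Fig. 1 (p. 29, accept/reject)] -/
def Kfin : Language Bool := {u | finFn u ∈ accTable B (Δ.TBL σ) Δ}

/-- "`|h| = histLen(|x|)`": the verdict query is being asked. [folklore] -/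
def IsLast : Language Bool := {u | (onesFn ∘ sndP) u = (Plumb.polyFn Δ.histLen ∘ fstP) u}

/-- **The language `K` of the `PSPACE` side.** [cite: FennerFortnowKurtzLi2003IC, Lemma 6.16, Lemma 6.17 and Thm. 6.18 (2) (p. 33)] -/
def KLang : Language Bool :=
  {u | (u ∈ Δ.IsLast ∧ u ∈ Δ.Kfin B σ) ∨ (u ∉ Δ.IsLast ∧ u ∈ Δ.Kcode B σ)}

end Defs

/-! ### `K ∈ PSPACE` -/

variable {Δ : AWPPDescr} {B : Language Bool} {σ : CohenCondition}

/-! ### Unfolding membership (definitional) -/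

/-- Unfolding `AccG`. [folklore] -/
theorem mem_AccG {w : List Bool} : w ∈ Δ.AccG B σ ↔ Δ.tmapFn w ∈ accTable B (Δ.TBL σ) Δ := Iff.rfl
/-- Unfolding `LenEqG`. [folklore] -/
theorem mem_LenEqG {w : List Bool} :
    w ∈ Δ.LenEqG ↔ (onesFn ∘ sndP) w = (Plumb.polyFn Δ.codeLen ∘ fstP ∘ fstP ∘ fstP) w := Iff.rfl
/-- Unfolding `ImpG`. [folklore] -/
theorem mem_ImpG {w : List Bool} : w ∈ Δ.ImpG B σ ↔ (w ∈ Δ.LenEqG → w ∈ Δ.AccG B σ) := Iff.rfl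
/-- Unfolding `GoodL`. [folklore] -/
theorem mem_GoodL {v : List Bool} :
    v ∈ Δ.GoodL B σ ↔ ∀ g : List Bool, g.length ≤ (X : Polynomial ℕ).eval v.length → boolPair v g ∈ Δ.ImpG B σ := Iff.rfl
/-- Unfolding `LenEqC`. [folklore] -/
theorem mem_LenEqC {v : List Bool} :
    v ∈ Δ.LenEqC ↔ (onesFn ∘ sndP) v = (Plumb.polyFn Δ.codeLen ∘ fstP ∘ fstP) v := Iff.rfl
/-- Unfolding `LenLtC`. [folklore] -/
theorem mem_LenLtC {w : List Bool} :
    w ∈ Δ.LenLtC ↔ (onesFn ∘ sndP) w = (Plumb.polyFn Δ.codeLen ∘ fstP ∘ fstP ∘ fstP) w ∧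
      bitsToNat (sndP w) < bitsToNat (sndP (fstP w)) := Iff.rfl
/-- Unfolding `NotGoodC`. [folklore] -/
theorem mem_NotGoodC {w : List Bool} : w ∈ Δ.NotGoodC B σ ↔ ¬ pairFn (fstP ∘ fstP) sndP w ∈ Δ.GoodL B σ := Iff.rfl
/-- Unfolding `ImpMin`. [folklore] -/
theorem mem_ImpMin {w : List Bool} : w ∈ Δ.ImpMin B σ ↔ (w ∈ Δ.LenLtC → w ∈ Δ.NotGoodC B σ) := Iff.rfl
/-- Unfolding `MinL`. [folklore] -/
theorem mem_MinL {v : List Bool} :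
    v ∈ Δ.MinL B σ ↔ ∀ c' : List Bool, c'.length ≤ (X : Polynomial ℕ).eval v.length → boolPair v c' ∈ Δ.ImpMin B σ := Iff.rfl
/-- Unfolding `LeastL`. [folklore] -/
theorem mem_LeastL {v : List Bool} : v ∈ Δ.LeastL B σ ↔ v ∈ Δ.LenEqC ∧ (v ∈ Δ.GoodL B σ ∧ v ∈ Δ.MinL B σ) := Iff.rfl
/-- Unfolding `CodeBit`. [folklore] -/
theorem mem_CodeBit {v : List Bool} :
    v ∈ Δ.CodeBit ↔ ((sndP v).drop ((KSide.idxFn Δ.segW Δ.slots ∘ fstP) v).length).head? = some true := Iff.rfl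
/-- Unfolding `LeastBit`. [folklore] -/
theorem mem_LeastBit {v : List Bool} : v ∈ Δ.LeastBit B σ ↔ v ∈ Δ.LeastL B σ ∧ v ∈ Δ.CodeBit := Iff.rfl
/-- Unfolding `Kcode`. [folklore] -/
theorem mem_Kcode {u : List Bool} :
    u ∈ Δ.Kcode B σ ↔ ∃ c : List Bool, c.length ≤ Δ.codeLen.eval u.length ∧ boolPair u c ∈ Δ.LeastBit B σ := Iff.rfl
/-- Unfolding `Kfin`. [folklore] -/
theorem mem_Kfin {u : List Bool} : u ∈ Δ.Kfin B σ ↔ finFn u ∈ accTable B (Δ.TBL σ) Δ := Iff.rfl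
/-- Unfolding `IsLast`. [folklore] -/
theorem mem_IsLast {u : List Bool} : u ∈ Δ.IsLast ↔ (onesFn ∘ sndP) u = (Plumb.polyFn Δ.histLen ∘ fstP) u := Iff.rfl
/-- Unfolding `KLang`. [folklore] -/
theorem mem_KLang {u : List Bool} :
    u ∈ Δ.KLang B σ ↔ (u ∈ Δ.IsLast ∧ u ∈ Δ.Kfin B σ) ∨ (u ∉ Δ.IsLast ∧ u ∈ Δ.Kcode B σ) := Iff.rfl

/-- `tmapFn ∈ FP`. [folklore] -/
theorem tmapFn_mem_FP (Δ : AWPPDescr) : Δ.tmapFn ∈ FP := by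
  have h3 : (fstP ∘ fstP ∘ fstP : List Bool → List Bool) ∈ FP := comp_mem_FP fstP_mem_FP (comp_mem_FP fstP_mem_FP fstP_mem_FP)
  exact pairFn_mem_FP h3 (pairFn_mem_FP h3 (pairFn_mem_FP
    (comp_mem_FP (KSide.prefFn_mem_FP _ _ _) (comp_mem_FP fstP_mem_FP fstP_mem_FP))
    (pairFn_mem_FP (comp_mem_FP sndP_mem_FP fstP_mem_FP) sndP_mem_FP)))

/-- `finFn ∈ FP`. [folklore] -/
theorem finFn_mem_FP : finFn ∈ FP :=
  pairFn_mem_FP fstP_mem_FP (pairFn_mem_FP fstP_mem_FP (pairFn_mem_FP sndP_mem_FP (const_mem_FP _)))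

/-- The length tests are in `P`. [folklore] -/
theorem LenEqG_mem_P (Δ : AWPPDescr) : Δ.LenEqG ∈ Classes.P :=
  setOf_apply_eq_apply_mem_P (comp_mem_FP onesFn_mem_FP sndP_mem_FP)
    (comp_mem_FP (Plumb.polyFn_mem_FP _) (comp_mem_FP fstP_mem_FP (comp_mem_FP fstP_mem_FP fstP_mem_FP)))

/-- `LenEqC ∈ P`. [folklore] -/
theorem LenEqC_mem_P (Δ : AWPPDescr) : Δ.LenEqC ∈ Classes.P :=
  setOf_apply_eq_apply_mem_P (comp_mem_FP onesFn_mem_FP sndP_mem_FP)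
    (comp_mem_FP (Plumb.polyFn_mem_FP _) (comp_mem_FP fstP_mem_FP fstP_mem_FP))

/-- `IsLast ∈ P`. [folklore] -/
theorem IsLast_mem_P (Δ : AWPPDescr) : Δ.IsLast ∈ Classes.P :=
  setOf_apply_eq_apply_mem_P (comp_mem_FP onesFn_mem_FP sndP_mem_FP) (comp_mem_FP (Plumb.polyFn_mem_FP _) fstP_mem_FP)

/-- `LenLtC ∈ P`. [folklore] -/
theorem LenLtC_mem_P (Δ : AWPPDescr) : Δ.LenLtC ∈ Classes.P := by
  have h1 : ({w | (onesFn ∘ sndP) w = (Plumb.polyFn Δ.codeLen ∘ fstP ∘ fstP ∘ fstP) w} : Language Bool) ∈ Classes.P :=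
    LenEqG_mem_P Δ
  have h2 : ({w | bitsToNat (sndP w) < bitsToNat (sndP (fstP w))} : Language Bool) ∈ Classes.P := by
    have h := preimage_mem_P ltVal_mem_P (pairFn_mem_FP sndP_mem_FP (comp_mem_FP sndP_mem_FP fstP_mem_FP))
    have heq : ({w | bitsToNat (sndP w) < bitsToNat (sndP (fstP w))} : Language Bool) =
        pairFn sndP (sndP ∘ fstP) ⁻¹' {u | bitsToNat (fstP u) < bitsToNat (sndP u)} := by
      refine Set.ext fun w => ?_
      show bitsToNat (sndP w) < bitsToNat (sndP (fstP w)) ↔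
        bitsToNat (fstP (pairFn sndP (sndP ∘ fstP) w)) < bitsToNat (sndP (pairFn sndP (sndP ∘ fstP) w))
      rw [pairFn_apply, fstP_boolPair, sndP_boolPair, Function.comp_apply]
    rw [heq]
    exact h
  exact inter_mem_P h1 h2

/-- `CodeBit ∈ P`. [cite: AroraBarakCC2009, §1.3] -/
theorem CodeBit_mem_P (Δ : AWPPDescr) : Δ.CodeBit ∈ Classes.P :=
  Kannan.setOf_bit_mem_P (comp_mem_FP (KSide.idxFn_mem_FP _ _) fstP_mem_FP) sndP_mem_FP true

/-- **`K ∈ PSPACE`** for a well-formed description over a Karp-`PSPACE`-complete `B` ("it is easy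
to see that `F_j ∈ FPSPACE` for `C^A = AWPP^A`"). [cite: FennerFortnowKurtzLi2003IC, Lemma 6.17 and the remark after it (p. 33)] [cite: AroraBarakCC2009, Thm. 4.2 and §4.2] -/
theorem KLang_mem_PSPACE (hB : IsComplete PSPACE B) (hwf : Δ.WellFormed) (σ : CohenCondition) : Δ.KLang B σ ∈ PSPACE := by
  have hP : ∀ {L : Language Bool}, L ∈ Classes.P → L ∈ PSPACE := fun h => P_subset_PSPACE_holds h
  have hT : Δ.TBL σ ∈ PSPACE := layerTBL_mem_PSPACE hB σ Δ.segW
  have hAcc : accTable B (Δ.TBL σ) Δ ∈ PSPACE := accTable_mem_PSPACE hB hB.1 hT hwf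
  have hAccG : Δ.AccG B σ ∈ PSPACE := preimage_mem_PSPACE hAcc (tmapFn_mem_FP Δ)
  have hImpG : Δ.ImpG B σ ∈ PSPACE := setOf_imp_mem_PSPACE_of_complete hB (hP (LenEqG_mem_P Δ)) hAccG
  have hGood : Δ.GoodL B σ ∈ PSPACE := polyForall_mem_PSPACE hImpG X
  have hNotGood : Δ.NotGoodC B σ ∈ PSPACE :=
    compl_mem_PSPACE (preimage_mem_PSPACE hGood (pairFn_mem_FP (comp_mem_FP fstP_mem_FP fstP_mem_FP) sndP_mem_FP))
  have hImpMin : Δ.ImpMin B σ ∈ PSPACE := setOf_imp_mem_PSPACE_of_complete hB (hP (LenLtC_mem_P Δ)) hNotGood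
  have hMin : Δ.MinL B σ ∈ PSPACE := polyForall_mem_PSPACE hImpMin X
  have hLeast : Δ.LeastL B σ ∈ PSPACE :=
    setOf_and_mem_PSPACE_of_complete hB (hP (LenEqC_mem_P Δ)) (setOf_and_mem_PSPACE_of_complete hB hGood hMin)
  have hLeastBit : Δ.LeastBit B σ ∈ PSPACE := setOf_and_mem_PSPACE_of_complete hB hLeast (hP (CodeBit_mem_P Δ))
  have hKcode : Δ.Kcode B σ ∈ PSPACE := polyExists_mem_PSPACE hLeastBit Δ.codeLen
  have hKfin : Δ.Kfin B σ ∈ PSPACE := preimage_mem_PSPACE hAcc finFn_mem_FP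
  have hLast : Δ.IsLast ∈ PSPACE := hP (IsLast_mem_P Δ)
  exact setOf_or_mem_PSPACE_of_complete hB (setOf_and_mem_PSPACE_of_complete hB hLast hKfin)
    (setOf_and_mem_PSPACE_of_complete hB (compl_mem_PSPACE hLast) hKcode)

/-! ### The intended bit -/

section Bit

variable (Δ : AWPPDescr) (B : Language Bool) (σ : CohenCondition)

/-- The knowledge of the completed rounds of `h` (the prefix of length `r · Lc`, `r = |h|/W/Cs`). [cite: FennerFortnowKurtzLi2003IC, Fig. 1 (p. 29, α)] -/
def prefKnow (x h : List Bool) : Fin (Δ.winCard σ x.length) → Option Bool :=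
  Δ.knowOf σ x.length (Δ.segW.eval x.length)
    (h.take (h.length / Δ.segW.eval x.length / Δ.slots.eval x.length * Δ.codeLen.eval x.length))

open scoped Classical in
/-- **The code of the round**: the least good code over the knowledge `ρ`, or all zeros if no code
is good. [cite: FennerFortnowKurtzLi2003IC, §6.3 eq. (6) (p. 29, f^σ(x, α)) and Lemma 6.17 (p. 33)] -/
def roundCode (x : List Bool) (ρ : Fin (Δ.winCard σ x.length) → Option Bool) : List Bool :=
  if h : ∃ c, Δ.IsLeastGood B σ x (Δ.segW.eval x.length) (Δ.codeLen.eval x.length) ρ c then Classical.choose h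
  else List.replicate (Δ.codeLen.eval x.length) false

/-- The bit index `k·W + o` addressed by the query after the history `h`. [cite: AroraBarakCC2009, §1.3] -/
def bitIdx (x h : List Bool) : ℕ :=
  h.length / Δ.segW.eval x.length % Δ.slots.eval x.length * Δ.segW.eval x.length + h.length % Δ.segW.eval x.length

/-- **The intended answer of `K` after the history `h`**: the verdict at the verdict position, else
the addressed bit of the round's code. [cite: FennerFortnowKurtzLi2003IC, Lemma 6.16 (p. 33) and Fig. 1 (p. 29)] -/
def kbit (x h : List Bool) : Bool :=
  if h.length = Δ.histLen.eval x.length then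
    Δ.winFn B σ x (fill (Δ.knowOf σ x.length (Δ.segW.eval x.length) h))
  else (Δ.roundCode B σ x (Δ.prefKnow σ x h)).getD (Δ.bitIdx x h) false

end Bit

/-- The round code is the least good code when there is one. [folklore] -/
theorem roundCode_eq_of_isLeastGood {x : List Bool} {ρ : Fin (Δ.winCard σ x.length) → Option Bool} {c : List Bool}
    (hc : Δ.IsLeastGood B σ x (Δ.segW.eval x.length) (Δ.codeLen.eval x.length) ρ c) : Δ.roundCode B σ x ρ = c := by
  classical
  unfold roundCode
  have h : ∃ c, Δ.IsLeastGood B σ x (Δ.segW.eval x.length) (Δ.codeLen.eval x.length) ρ c := ⟨c, hc⟩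
  rw [dif_pos h]
  exact (Classical.choose_spec h).unique hc

/-- The round code is all zeros when no code is good. [folklore] -/
theorem roundCode_eq_of_not_exists {x : List Bool} {ρ : Fin (Δ.winCard σ x.length) → Option Bool}
    (h : ¬ ∃ c, Δ.IsLeastGood B σ x (Δ.segW.eval x.length) (Δ.codeLen.eval x.length) ρ c) :
    Δ.roundCode B σ x ρ = List.replicate (Δ.codeLen.eval x.length) false := by
  classical
  unfold roundCode
  rw [dif_neg h]

/-- The round code has length `Lc`. [folklore] -/
theorem length_roundCode (x : List Bool) (ρ : Fin (Δ.winCard σ x.length) → Option Bool) :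
    (Δ.roundCode B σ x ρ).length = Δ.codeLen.eval x.length := by
  classical
  by_cases h : ∃ c, Δ.IsLeastGood B σ x (Δ.segW.eval x.length) (Δ.codeLen.eval x.length) ρ c
  · obtain ⟨c, hc⟩ := h
    rw [Δ.roundCode_eq_of_isLeastGood hc]
    exact hc.1
  · rw [Δ.roundCode_eq_of_not_exists h, List.length_replicate]

/-- When no code is good, `pick` returns `none` and the round code is zero. [folklore] -/
theorem pick_eq_none_iff_roundCode {x : List Bool} {ρ : Fin (Δ.winCard σ x.length) → Option Bool} :
    Δ.pick B σ x (Δ.segW.eval x.length) (Δ.codeLen.eval x.length) ρ = none ↔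
      ¬ ∃ c, Δ.IsLeastGood B σ x (Δ.segW.eval x.length) (Δ.codeLen.eval x.length) ρ c :=
  Δ.pick_eq_none_iff

/-! ### Semantics of `K` -/

/-- Semantics of `tmapFn`. [folklore] -/
theorem tmapFn_apply (Δ : AWPPDescr) (x h c g : List Bool) :
    Δ.tmapFn (boolPair (boolPair (boolPair x h) c) g) =
      boolPair x (tcode x (h.take (h.length / Δ.segW.eval x.length / Δ.slots.eval x.length * Δ.codeLen.eval x.length)) c g) := by
  simp only [tmapFn, pairFn_apply, Function.comp_apply, fstP_boolPair, sndP_boolPair, KSide.prefFn_apply, tcode]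

/-- Semantics of `GoodL` (for codes of length at least `Lc`). [cite: FennerFortnowKurtzLi2003IC, Lemma 6.17 (p. 33)] -/
theorem mem_GoodL_iff (hwf : Δ.WellFormed) (hcat : Δ.Categorical B σ) (x h c : List Bool)
    (hc : Δ.codeLen.eval x.length ≤ c.length) :
    boolPair (boolPair x h) c ∈ Δ.GoodL B σ ↔
      Δ.GoodK B σ x (Δ.segW.eval x.length) (Δ.codeLen.eval x.length) (Δ.prefKnow σ x h) c := by
  simp only [mem_GoodL, mem_ImpG, mem_LenEqG, mem_AccG, Function.comp_apply, eval_X, sndP_boolPair, fstP_boolPair,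
    onesFn_eq_replicate, Plumb.polyFn_apply, ADH.ones_inj, tmapFn_apply]
  unfold GoodK prefKnow
  constructor
  · intro hall g hg
    have := hall g (by rw [length_boolPair]; omega) hg
    rwa [TBL, Δ.mem_accTable_iff_winFn hwf hcat] at this
  · intro hall g _ hg
    rw [TBL, Δ.mem_accTable_iff_winFn hwf hcat]
    exact hall g hg

/-- Semantics of `LeastL`. [cite: FennerFortnowKurtzLi2003IC, Lemma 6.17 (p. 33)] -/
theorem mem_LeastL_iff (hwf : Δ.WellFormed) (hcat : Δ.Categorical B σ) (x h c : List Bool) :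
    boolPair (boolPair x h) c ∈ Δ.LeastL B σ ↔
      Δ.IsLeastGood B σ x (Δ.segW.eval x.length) (Δ.codeLen.eval x.length) (Δ.prefKnow σ x h) c := by
  simp only [mem_LeastL, mem_LenEqC, mem_MinL, mem_ImpMin, mem_LenLtC, mem_NotGoodC, Function.comp_apply, eval_X,
    sndP_boolPair, fstP_boolPair, onesFn_eq_replicate, Plumb.polyFn_apply, ADH.ones_inj, pairFn_apply]
  unfold IsLeastGood
  constructor
  · rintro ⟨hlen, hgood, hmin⟩
    refine ⟨hlen, (Δ.mem_GoodL_iff hwf hcat x h c hlen.ge).1 hgood, fun c' hc' hlt hg => ?_⟩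
    refine hmin c' (by rw [length_boolPair]; omega) ⟨hc', hlt⟩ ?_
    exact (Δ.mem_GoodL_iff hwf hcat x h c' hc'.ge).2 hg
  · rintro ⟨hlen, hgood, hmin⟩
    refine ⟨hlen, (Δ.mem_GoodL_iff hwf hcat x h c hlen.ge).2 hgood, fun c' _ ⟨hc', hlt⟩ hg => ?_⟩
    exact hmin c' hc' hlt ((Δ.mem_GoodL_iff hwf hcat x h c' hc'.ge).1 hg)

/-- Semantics of `CodeBit`. [cite: AroraBarakCC2009, §1.3] -/
theorem mem_CodeBit_iff (Δ : AWPPDescr) (x h c : List Bool) :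
    boolPair (boolPair x h) c ∈ Δ.CodeBit ↔ c.getD (Δ.bitIdx x h) false = true := by
  rw [mem_CodeBit, sndP_boolPair, Function.comp_apply, fstP_boolPair, KSide.length_idxFn_apply,
    Kannan.head?_drop_eq_some_true_iff]
  rfl

/-- Semantics of `Kcode`: the addressed bit of the round's code. [cite: FennerFortnowKurtzLi2003IC, Lemma 6.16 (p. 33)] -/
theorem mem_Kcode_iff (hwf : Δ.WellFormed) (hcat : Δ.Categorical B σ) (x h : List Bool) :
    boolPair x h ∈ Δ.Kcode B σ ↔ (Δ.roundCode B σ x (Δ.prefKnow σ x h)).getD (Δ.bitIdx x h) false = true := by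
  classical
  simp only [mem_Kcode, mem_LeastBit, Δ.mem_LeastL_iff hwf hcat, mem_CodeBit_iff]
  constructor
  · rintro ⟨c, -, hc, hbit⟩
    rwa [Δ.roundCode_eq_of_isLeastGood hc]
  · intro hbit
    by_cases h : ∃ c, Δ.IsLeastGood B σ x (Δ.segW.eval x.length) (Δ.codeLen.eval x.length) (Δ.prefKnow σ x h) c
    · obtain ⟨c, hc⟩ := h
      rw [Δ.roundCode_eq_of_isLeastGood hc] at hbit
      refine ⟨c, ?_, hc, hbit⟩
      rw [hc.1, length_boolPair]
      exact TM2Iter.eval_mono _ (by omega)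
    · rw [Δ.roundCode_eq_of_not_exists h, List.getD_eq_getElem?_getD, List.getElem?_replicate] at hbit
      split_ifs at hbit <;> simp at hbit

/-- Semantics of `Kfin`: the verdict. [cite: FennerFortnowKurtzLi2003IC, Fig. 1 (p. 29)] -/
theorem mem_Kfin_iff (hwf : Δ.WellFormed) (hcat : Δ.Categorical B σ) (x h : List Bool) :
    boolPair x h ∈ Δ.Kfin B σ ↔ Δ.winFn B σ x (fill (Δ.knowOf σ x.length (Δ.segW.eval x.length) h)) = true := by
  rw [mem_Kfin]
  have heq : finFn (boolPair x h) = boolPair x (tcode x h [] []) := by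
    simp only [finFn, pairFn_apply, fstP_boolPair, sndP_boolPair, tcode]
  rw [heq, TBL, Δ.mem_accTable_iff_winFn hwf hcat, Δ.layerFill_knowOf_nil (Δ.two_reach_le_segW x.length)]

/-- Semantics of `IsLast`. [folklore] -/
theorem mem_IsLast_iff (Δ : AWPPDescr) (x h : List Bool) :
    boolPair x h ∈ Δ.IsLast ↔ h.length = Δ.histLen.eval x.length := by
  rw [mem_IsLast, Function.comp_apply, Function.comp_apply, sndP_boolPair, fstP_boolPair, onesFn_eq_replicate,
    Plumb.polyFn_apply, ADH.ones_inj]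

/-- **Semantics of `K`**: for `Δ` well formed and categorical over `σ`, `⟨x, h⟩ ∈ K` iff the
intended bit `kbit x h` is `1`. [cite: FennerFortnowKurtzLi2003IC, Lemma 6.16 and Lemma 6.17 (p. 33)] -/
theorem mem_KLang_iff_kbit (hwf : Δ.WellFormed) (hcat : Δ.Categorical B σ) (x h : List Bool) :
    boolPair x h ∈ Δ.KLang B σ ↔ Δ.kbit B σ x h = true := by
  rw [mem_KLang, mem_IsLast_iff, Δ.mem_Kfin_iff hwf hcat, Δ.mem_Kcode_iff hwf hcat]
  unfold kbit
  split_ifs with h <;> simp [h]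

end AWPPDescr

end Literature.Barriers.QuantumAdvantage

end
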